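import Summits.ABC.IUTFork.LDHGenuinePerImageSufficiencyRamified
import Literature.IUT.LogVolume.Corollary22RatPointDictionary
import Literature.IUT.LogVolume.Corollary22PartIIUpTo
import HarnessLib

/-!
# The fork at [IUTchIII] Corollary 3.12, L-DH level, READING (P): the ramification-sharpened sufficient half at a RATIONAL point,
# with the extra place `l` itself — every Szpiro-bad Frey row becomes ONE arithmetic test modulo the ramification of `K` over `l`
# (abc-iut cell, crux ThetaPartII = stmt-ABC-19678, stub `stub_cor312PerImage`; task «C:PERIMAGE-1061-13» and its siblings)

Record-only PROOF file (D-0012) of the abc-iut cell (WAVE-3 discharge seat abc-iut-c312-d1, gen 8); sequel to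
`LDHGenuinePerImageSufficiencyRamified.lean` (p467927). TAKES NO SIDE on [IUTchIII] Cor. 3.12.

* **`Cor22.cor312PerImageOf_ratPoint_of_ramified_over_l`** — for `q ∈ ℚ ∖ {0,1}`, a prime `l ≥ 5`, `m ≥ 1`: if
  `((l+1)/24 − 1/(2l))·log q^{∤2l}(q) ≤ ((l+5)/4 − 1)·((1 − 1/l)·log 𝔣^{∤2l}(q) + (1 − 1/m)·log l) + ((l+5)/4)·log π`
  then `T.Cor312PerImageOf` at EVERY genuine Θ-volume datum `T` of `(q, l)` all of whose places of `K` over `l` have ramification index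
  `≥ m` over `ℚ`. With `m = l − 1` (⇐ `μ_l ⊆ K = F(E_F[l])`, Weil pairing — GAP-LEDGER G-c312d1g8-1, NOT in the tree) this is the test
  «perimage_zeta_margin ≥ 0» of the seat's STATUS note 2026-08-26T20:2xZ: pure arithmetic of the row, the two logarithmic sums being the
  EXACT values of `Corollary22RatPointDictionary.lean` (p462751). The instance `(λ_1061, 13)` is `LDHGenuinePerImageFrey1061Thirteen.lean`.

Nothing here asserts the existence of data, Cor. 3.12 in general, or abc; the ramification hypothesis is explicit; proved-as-typed ≠ in print.
[cite: Mochizuki2012, IUTchIII Cor. 3.12 p. 173–174; IUTchIV Thm. 1.10 Step (ii) p. 24, Step (v) p. 27–29] [cite: MochizukiGenEll2010, Prop. 1.7 (i)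
p. 9–10, Def. 1.5 (iii) p. 8] [claim: Mochizuki2012, status: disputed] for every IUT quotation. PROOF-ONLY: no definitions.
-/

noncomputable section

open NumberField IsDedekindDomain Ideal Module

namespace Literature.IUT.LogVolume.Cor22

open Literature.NumberTheory.DiophantineGeometry.GenEll Summit.ABC.IUTFork Literature.IUT.HodgeTheaters
open Literature.NumberTheory.DiophantineGeometry.UniformABCConjecture Rat.HeightOneSpectrum

variable {l : ℕ}

/-! ## At a RATIONAL point: the place over `l` itself (`Sₓ = {l}`) -/

/-- **RATIONAL POINTS, RAMIFICATION OVER `l`**: for `q ∈ ℚ ∖ {0, 1}`, a prime `l ≥ 5` and `m ≥ 1`: if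
`((l+1)/24 − 1/(2l))·log q^{∤2l}(q) ≤ ((l+5)/4 − 1)·((1 − 1/l)·log 𝔣^{∤2l}(q) + (1 − 1/m)·log l) + ((l+5)/4)·log π`
(pure arithmetic of the point — `log q^{∤2l}`, `log 𝔣^{∤2l}` are the exact sums of `Corollary22RatPointDictionary`), then
`T.Cor312PerImageOf` holds at EVERY genuine Θ-volume datum `T` of `(q, l)` all of whose places of `K` over `l` have ramification
index `≥ m` over `ℚ` (`m = l − 1` follows from `μ_l ⊆ K`, GAP-LEDGER G-c312d1g8-1). The place over `l` is never in `𝕍^bad_mod`, so no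
coprimality input is needed. [cite: Mochizuki2012, IUTchIII Cor. 3.12 p. 173–174] [cite: Mochizuki2012, IUTchIV Thm. 1.10 Step (ii) p. 24]
[claim: Mochizuki2012, status: disputed] -/
theorem cor312PerImageOf_ratPoint_of_ramified_over_l {q : ℚ} (hq0 : q ≠ 0) (hq1 : q ≠ 1) (hl : l.Prime)
    (h5 : 5 ≤ l) {m : ℕ} (hm : 0 < m)
    (h : (((l : ℝ) + 1) / 24 - 1 / (2 * l)) * logQAvoid (ratPoint q) {2, l} ≤
      (((l : ℝ) + 5) / 4 - 1) * ((1 - 1 / (l : ℝ)) * logCondAvoid (ratPoint q) {2, l}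
          + (1 - (m : ℝ)⁻¹) * Real.log l)
        + ((l : ℝ) + 5) / 4 * Real.log Real.pi)
    (T : ThetaVolumeDatumAt (ratPoint q) l)
    (hram : letI := T.instFieldF; letI := T.instNumberFieldF; letI := T.instAlgebraF; letI := T.instFieldK
      letI := T.instNumberFieldK; letI := T.instAlgebraK
      letI : Algebra (ratPoint q).F T.K := ((algebraMap T.F T.K).comp (algebraMap (ratPoint q).F T.F)).toAlgebra
      ∀ v : HeightOneSpectrum (𝓞 (ratPoint q).F), ((l : ℕ) : 𝓞 (ratPoint q).F) ∈ v.asIdeal →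
        ∀ w ∈ IsDedekindDomain.primesOverFinset v.asIdeal (𝓞 T.K), m ≤ ramificationIdx' v.asIdeal w) :
    T.Cor312PerImageOf := by
  classical
  letI := T.instFieldF; letI := T.instNumberFieldF; letI := T.instAlgebraF; letI := T.instFieldK
  letI := T.instNumberFieldK; letI := T.instAlgebraK
  letI : Algebra (ratPoint q).F T.K := ((algebraMap T.F T.K).comp (algebraMap (ratPoint q).F T.F)).toAlgebra
  have hUP := ratPoint_mem_UPle_one hq0 hq1
  have hd1 : dmod (ratPoint q) = 1 := dmod_eq_one_of_degree_le_one (le_of_eq (degree_ratPoint _))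
  -- the place over `l`, as a place of `F_tpd = ℚ` of the point
  have hgen : natGenerator ((primesEquiv (R := 𝓞 ℚ)).symm ⟨l, hl⟩) = l :=
    congrArg Subtype.val ((primesEquiv (R := 𝓞 ℚ)).apply_symm_apply ⟨l, hl⟩)
  obtain ⟨vl, hv⟩ : ∃ v : HeightOneSpectrum (𝓞 (ratPoint q).F),
      v = (primesEquiv (R := 𝓞 ℚ)).symm ⟨l, hl⟩ := ⟨_, rfl⟩
  have hmem : ((l : ℕ) : 𝓞 (ratPoint q).F) ∈ vl.asIdeal := by
    rw [hv]
    exact (natCast_mem_asIdeal_iff _ l).2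
      (by rw [hgen])
  -- the place over `l` is not in `𝕍^bad_mod` (by definition of "away from `2l`")
  have hnot : vl ∉ badPlacesAvoid (ratPoint q) {2, l} := by
    intro hbad
    unfold badPlacesAvoid at hbad
    exact (Finset.mem_filter.1 hbad).2 l (Finset.mem_insert_of_mem (Finset.mem_singleton_self l)) hmem
  have hram' : ∀ v ∈ ({vl} : Finset (HeightOneSpectrum (𝓞 (ratPoint q).F))),
      ∀ w ∈ IsDedekindDomain.primesOverFinset v.asIdeal (𝓞 T.K), m ≤ ramificationIdx' v.asIdeal w := by
    intro v hv' w hw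
    rw [Finset.mem_singleton] at hv'
    rw [hv'] at hw ⊢
    exact hram vl hmem w hw
  have hnorm : ∑ v ∈ ({vl} : Finset (HeightOneSpectrum (𝓞 (ratPoint q).F))),
      Real.log (absNorm v.asIdeal : ℝ) = Real.log l := by
    rw [Finset.sum_singleton, hv]
    have h := congrArg (fun n : ℕ => Real.log (n : ℝ))
      (absNorm_asIdeal_eq_natGenerator ((primesEquiv (R := 𝓞 ℚ)).symm ⟨l, hl⟩))
    rw [hgen] at h
    exact h
  refine T.cor312PerImageOf_of_le_logDiff_logCond_ramified hUP.1.1 hl.pos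
    (by rw [hd1]; have : (5 : ℝ) ≤ l := by exact_mod_cast h5
        push_cast; linarith)
    {vl} (Finset.disjoint_singleton_right.2 hnot) hm hram' ?_
  have harch : ThetaVolumeInput.archLogTheta l = ((l : ℝ) + 5) / 4 * Real.log Real.pi := rfl
  -- `log-diff` vanishes on `ℚ`-points (`|disc ℚ| = 1`)
  have hld : (ratPoint q).logDiff = 0 := by
    rw [NFPoint.logDiff_eq_log_discr]
    change ((Module.finrank ℚ ℚ : ℕ) : ℝ)⁻¹ * Real.log ((NumberField.discr ℚ).natAbs : ℕ) = 0
    rw [Rat.numberField_discr]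
    simp
  rw [harch, hd1, hnorm, hld, degree_ratPoint]
  push_cast
  simp only [inv_one, one_mul, zero_add]
  exact h

end Literature.IUT.LogVolume.Cor22

end
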